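import Mathlib.Analysis.InnerProductSpace.PiL2
import Mathlib.Analysis.Calculus.Deriv.Basic
import Mathlib.Analysis.Calculus.ContDiff.Defs
import Mathlib.Topology.Algebra.InfiniteSum.Basic
import Mathlib.Order.Filter.AtTopBot.Basic
import Mathlib.Analysis.Normed.Group.InfiniteSum
import Mathlib.Data.Nat.Pairing
import Literature.MathematicalPhysics.StatisticalMechanics.Crystallization
import HarnessLib

/-!
# Theil 2006: crystallization in two dimensions (triangular lattice)

Topic: `Literature/MathematicalPhysics/StatisticalMechanics`. Statement source `Theil2006` of the
sub-problem `AtomisticToContinuum/Crystallization` (the only proved crystallization theorem for a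
Lennard-Jones-like *pair* potential invariant under the Euclidean group; Blanc–Lewin 2015, §2.3).
This file vendors the principal definitions and results of

* F. Theil, *A proof of crystallization in two dimensions*, Comm. Math. Phys. **262** (2006)
  209–236 (read in the author's accepted preprint of 26 Aug 2005, identical numbering):
  §1 normalization (1), Theorem 1.1 (ground state energy), Theorem 1.2 (ground states with
  periodic boundary conditions), Corollary 1.3 (stability against compactly supported
  perturbations), the renormalized potential `V_*` (§1, Notation), Lemma 2.2 (minimum distance),
  Proposition 2.3 with (7), (18) (combinatorial bound on the number of short-range bonds).

All results are NAMED FACTS (`def … : Prop`, never asserted; users take `(h : FactName)`); the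
definitions are real. The upper-bound half of Theorem 1.1 (`limsup_N min_y E/N ≤ -3`: patches of
`A₂` as trial states, by normalization (1) alone) is PROVED at the end of the file
(`Theil2006.IsNormalized.eventually_exists_interactionEnergy_le`,
`Theil2006.IsNormalized.eventually_minEnergy_div_le`).

## The setting (Theil 2006, §1)

Particles are labelled by a finite set `X_N` (`Fin N` here) with positions `y : X_N → ℝ²`; the
energy is `E(y) = ½ ∑_{x ≠ x'} V(|y(x) - y(x')|) = ∑_{{x,x'} ⊂ X_N} V(|y(x) - y(x')|)`, which is
the tree's `Literature.StatMech.interactionEnergy V y` (`∑_{i<j}`) in dimension `d = 2`. The reference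
lattice is the triangular lattice `A₂ = ½ (2 1; 0 √3) ℤ² ⊂ ℝ²`, i.e. `ℤ b₁ + ℤ b₂` with
`b₁ = (1, 0)`, `b₂ = (1/2, √3/2)`; we label its points by `ℤ × ℤ` through the injective additive
map `triPoint (m, n) = m b₁ + n b₂` (`triPoint_injective`), so that infinite configurations
`y : A₂ → ℝ²` (Theorem 1.2, Corollary 1.3) are functions `ℤ × ℤ → ℝ²` and `L A₂` is
`L • (ℤ × ℤ)`.

Hypotheses on the pair potential `V` (Theorem 1.1, with `α ∈ (0, α₀)`), bundled as
`Theil2006.IsAdmissible α V`: `V ∈ C²(1-α, ∞)`, `lim_{r→∞} V(r) = 0`, the normalization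
(1) `min_{r ≥ 0} ∑_{ξ ∈ A₂∖{0}} V(r|ξ|) = ∑_{ξ ∈ A₂∖{0}} V(|ξ|) = -6`, and
(2) `V(r) ≥ 1/α` on `[0, 1-α]`, (3) `V''(r) ≥ 1` on `(1-α, 1+α)`, (4) `V(r) ≥ -α` on
`[1+α, 4/3]`, (5) `|V''(r)| ≤ α r⁻⁷` on `(4/3, ∞)`.

## Main definitions

* `Theil2006.triVec₁`, `triVec₂`, `triPoint : ℤ × ℤ →+ ℝ²`, `triangularLattice : Set ℝ²` (`A₂`);
* `Theil2006.latticeSum V r = ∑_{ξ ∈ A₂∖{0}} V(r|ξ|)`, `renormalizedPotential V r = V_*(r) =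
  ⅙ latticeSum V r` (energy per nearest-neighbour bond of the dilated lattice `r A₂`);
* `Theil2006.IsNormalized V` ((1) and `V → 0`), `Theil2006.IsAdmissible α V` ((1)–(5));
* `Theil2006.minEnergy V N = inf_{y : X_N → ℝ²} E(y)` (over ALL configurations, as in the paper);
* `Theil2006.IsPeriodic L y`, `periodicEnergy V L y = E_L^per(y)`; `IsClampedOutside 𝒜 y`,
  `dirichletEnergy V 𝒜 y = E_𝒜(y)`;
* `Theil2006.shortRangePairs α y = 𝒮(y)`, `nbhd α y x = 𝒩(x)`, `defects α y = ∂X(y)`.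

## Named facts (source item → decl)

| Theil 2006 | decl | status |
|---|---|---|
| Thm 1.1 (ground state energy `→ -3`) | `Theil2006_groundStateEnergy` | fact |
| Thm 1.1, upper bound `limsup ≤ -3` | `Theil2006.IsNormalized.eventually_minEnergy_div_le` | proved |
| Thm 1.2 (periodic b.c.: ground states are translates of `A₂`) | `Theil2006_periodicGroundStates` | fact — MISSTATED as printed (see its docstring); corrected form `Theil2006_periodicGroundStates_upToRotation` in `Theil2006Periodic.lean` |
| Cor 1.3 (Dirichlet b.c.) | `Theil2006_dirichletGroundStates` | fact |
| Lemma 2.2 (minimum distance `> 1-α`) | `Theil2006_minimumDistance` | fact |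
| Prop 2.3, (7), (18) (`#𝒮 ≤ 3N - ½ #∂X`, `#𝒩(x) ≤ 7`) | `Theil2006_shortRangeBonds` | fact |

## Wording risks / design choices

* **Real-valued `V` (soft core).** Theil allows `V : [0,∞) → (-∞, +∞]` with a hard core
  `V = +∞` on `[0, ρ₀]`, `ρ₀ ≤ 1-α` ("the assumptions on `V` allow both for hard-core … and
  soft-core interactions"). Here `V : ℝ → ℝ`, so only the soft-core sub-case is vendored (a
  restriction of the printed theorem, never a strengthening); values of `V` on `(-∞, 0)` are
  irrelevant. (The printed "`V : [0,∞) → [0,∞]`" in Theorem 1.1 is a misprint: `V(1) < 0` by (1).)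
* **Infimum over all configurations.** `minEnergy` is `⨅` over all `y : Fin N → ℝ²` (coincident
  particles cost `V(0) ≥ 1/α`), as printed (`min_{y : X_N → ℝ²}`); it is NOT the tree's
  `groundStateEnergy V 2 N` (injective configurations). The `⨅` is a genuine infimum whenever `V`
  is bounded below (`minEnergy_le`), which (1)–(5) imply (Lemma 2.1 (11): `V ≥ -2`); the paper's
  `min` (attained) is not needed for Theorem 1.1, and Lemma 2.2 / Theorems 1.2–1.3 quantify over
  minimizers, asserting nothing when none exists.
* **Lattice sums are `tsum`s.** In (1) we require summability of `ξ ↦ V(r|ξ|)` over `A₂∖{0}` for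
  every `r > 0` explicitly (implied in the paper by (5) and `V → 0`, Lemma 2.1 (12):
  `|V(r)| ≤ α r⁻⁵` for `r ≥ 4/3`), so no junk value enters the normalization; `r = 0` is dropped
  from "`min_{r ≥ 0}`" (there the sum is `+∞ ≥ -6` in the paper). In `periodicEnergy` and
  `dirichletEnergy` the inner sums over `A₂` are `tsum`s (junk `0` if not summable); for an
  admissible `V` and an `L`-periodic (resp. clamped) `y` the summand is `O(|ξ|⁻⁵)` on a finite union
  of translates of `L A₂` (resp. on `A₂`), hence summable, so the facts carry no junk case.
* **Representatives of `A₂ / L A₂`.** `E_L^per` sums `x` over `A₂ ∩ L U` for a half-open unit cell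
  `U`; by `L A₂`-periodicity of `y` the inner sum only depends on `x mod L A₂`, so we sum over the
  representatives `{m b₁ + n b₂ : 0 ≤ m, n < L}` (`Fin L × Fin L`). We require `L ≥ 1` (for `L = 0`
  the printed constraint is vacuous and the sum degenerate; the paper's `L ∈ ℕ` means `L ≥ 1`).
* `α₀ ∈ (0, 1/3)` is existential and may differ between the facts, exactly as printed (each
  statement has its own "there exists `α₀`").
-/

noncomputable section

open scoped BigOperators Topology
open Filter Set

namespace Literature.MathematicalPhysics.StatisticalMechanics

namespace Theil2006

/-! ## The triangular lattice `A₂` -/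

/-- The Euclidean plane `ℝ²`. [folklore] -/
abbrev Plane : Type := EuclideanSpace ℝ (Fin 2)

/-- First basis vector `b₁ = (1, 0)` of `A₂ = ½ (2 1; 0 √3) ℤ²`. [cite: Theil2006, §1] -/
def triVec₁ : Plane := !₂[1, 0]

/-- Second basis vector `b₂ = (1/2, √3/2)` of `A₂ = ½ (2 1; 0 √3) ℤ²`. [cite: Theil2006, §1] -/
def triVec₂ : Plane := !₂[1 / 2, √3 / 2]

/-- The labelling `ℤ² → A₂`, `(m, n) ↦ m b₁ + n b₂ = ½ (2 1; 0 √3) (m, n)ᵀ`, an injective additive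
map (`triPoint_injective`) whose range is the triangular lattice `A₂`. [cite: Theil2006, §1] -/
def triPoint : ℤ × ℤ →+ Plane where
  toFun k := (k.1 : ℝ) • triVec₁ + (k.2 : ℝ) • triVec₂
  map_zero' := by simp
  map_add' k k' := by
    simp only [Prod.fst_add, Prod.snd_add, Int.cast_add, add_smul]
    abel

/-- The triangular lattice `A₂ = ½ (2 1; 0 √3) ℤ² ⊂ ℝ²` (Theil 2006, §1; the conjectured and, under
Theorem 1.1's hypotheses, proved ground-state geometry in two dimensions). [cite: Theil2006, §1] -/
def triangularLattice : Set Plane := Set.range triPoint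

/-- First coordinate of `m b₁ + n b₂`: `m + n/2`. [folklore] -/
@[simp] theorem triPoint_apply_zero (k : ℤ × ℤ) : triPoint k 0 = k.1 + k.2 / 2 := by
  simp [triPoint, triVec₁, triVec₂]; ring

/-- Second coordinate of `m b₁ + n b₂`: `(√3/2) n`. [folklore] -/
@[simp] theorem triPoint_apply_one (k : ℤ × ℤ) : triPoint k 1 = √3 / 2 * k.2 := by
  simp [triPoint, triVec₁, triVec₂]; ring

/-- `|m b₁ + n b₂|² = m² + m n + n²` (the norm form of `A₂`). [folklore] -/
theorem norm_triPoint_sq (k : ℤ × ℤ) :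
    ‖triPoint k‖ ^ 2 = ((k.1 ^ 2 + k.1 * k.2 + k.2 ^ 2 : ℤ) : ℝ) := by
  rw [EuclideanSpace.norm_sq_eq, Fin.sum_univ_two, Real.norm_eq_abs, Real.norm_eq_abs, sq_abs,
    sq_abs, triPoint_apply_zero, triPoint_apply_one]
  have h3 : (√3 : ℝ) ^ 2 = 3 := Real.sq_sqrt (by norm_num)
  push_cast
  linear_combination ((k.2 : ℝ) ^ 2 / 4) * h3

/-- The norm form `m² + m n + n²` is `≥ 1` off the origin. [folklore] -/
theorem one_le_normForm {k : ℤ × ℤ} (hk : k ≠ 0) : 1 ≤ k.1 ^ 2 + k.1 * k.2 + k.2 ^ 2 := by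
  obtain ⟨p, q⟩ := k
  by_cases hq : q = 0
  · subst hq
    have hp : p ≠ 0 := by rintro rfl; exact hk rfl
    have : 0 < p ^ 2 := by positivity
    simp only; nlinarith
  · have h1 : 0 < q ^ 2 := by positivity
    simp only; nlinarith [sq_nonneg (2 * p + q)]

/-- Non-zero points of `A₂` have norm `≥ 1` (the nearest-neighbour distance of `A₂` is `1`; cf.
Remark 2.5: `#{η' ∈ A₂ | |η - η'| ∈ (0,1]} = 6`). [cite: Theil2006, §2.3 Remark 2.5] -/
theorem one_le_norm_triPoint {k : ℤ × ℤ} (hk : k ≠ 0) : 1 ≤ ‖triPoint k‖ := by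
  have h : (1 : ℝ) ≤ ‖triPoint k‖ ^ 2 := by
    rw [norm_triPoint_sq]; exact_mod_cast one_le_normForm hk
  nlinarith [norm_nonneg (triPoint k)]

/-- The labelling `ℤ² → A₂` is injective. [folklore] -/
theorem triPoint_injective : Function.Injective triPoint := by
  refine (injective_iff_map_eq_zero triPoint).2 fun k hk => ?_
  by_contra h
  have := one_le_norm_triPoint h
  rw [hk, norm_zero] at this
  exact absurd this (by norm_num)

/-- `b₁ ∈ A₂`. [folklore] -/
theorem triVec₁_mem_triangularLattice : triVec₁ ∈ triangularLattice :=
  ⟨(1, 0), by simp [triPoint]⟩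

/-! ## Lattice sums, the normalization (1) and the hypotheses (2)–(5) -/

/-- The lattice sum `∑_{ξ ∈ A₂∖{0}} V(r|ξ|)` of the potential over the dilated triangular lattice
`r A₂` (Theil 2006, (1); `= f(r, A₂)` of Fig. 1). A `tsum` (junk value `0` if not summable; the
facts below assume summability for `r > 0`). [cite: Theil2006, §1 (1)] -/
def latticeSum (V : ℝ → ℝ) (r : ℝ) : ℝ :=
  ∑' k : {k : ℤ × ℤ // k ≠ 0}, V (r * ‖triPoint k.1‖)

/-- The **renormalized potential** `V_*(r) = ⅙ ∑_{ξ ∈ A₂∖{0}} V(r|ξ|)`: the energy per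
nearest-neighbour bond of the homogeneously dilated triangular lattice `r A₂` (Theil 2006, §1,
Notation; equivalently (22) `V_*(s) = ∑_{λ ∈ Λ} m(λ) V(λ s)`). [cite: Theil2006, §1 Notation] -/
def renormalizedPotential (V : ℝ → ℝ) (r : ℝ) : ℝ :=
  latticeSum V r / 6

/-- **Normalized potential** (Theil 2006, §1, "normalized in the sense that `lim_{r→∞} V(r) = 0`
and (1) `min_{r ≥ 0} ∑_{ξ ∈ A₂∖{0}} V(r|ξ|) = ∑_{ξ ∈ A₂∖{0}} V(|ξ|) = -6`"): the lattice sums are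
summable for `r > 0` (explicit here, implied there by (5)), the sum at `r = 1` is `-6`, and no
dilation does better. [cite: Theil2006, §1 (1)] -/
structure IsNormalized (V : ℝ → ℝ) : Prop where
  /-- `V(r) → 0` as `r → ∞` -/
  tendsto_zero : Tendsto V atTop (𝓝 0)
  /-- the lattice sums `∑_{ξ ≠ 0} V(r|ξ|)` converge for `r > 0` -/
  summable : ∀ r : ℝ, 0 < r → Summable fun k : {k : ℤ × ℤ // k ≠ 0} => V (r * ‖triPoint k.1‖)
  /-- `∑_{ξ ∈ A₂∖{0}} V(|ξ|) = -6` -/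
  latticeSum_one : latticeSum V 1 = -6
  /-- `r = 1` minimises the dilated lattice sums: `-6 ≤ ∑_{ξ ≠ 0} V(r|ξ|)` for all `r > 0` -/
  le_latticeSum : ∀ r : ℝ, 0 < r → -6 ≤ latticeSum V r

/-- **The hypotheses of Theil 2006, Theorem 1.1** for the parameter `α`: `V` normalized ((1) and
`V → 0`), `V ∈ C²(1-α, ∞)`, and (2) `V(r) ≥ 1/α` for `r ∈ [0, 1-α]`, (3) `V''(r) ≥ 1` for
`r ∈ (1-α, 1+α)`, (4) `V(r) ≥ -α` for `r ∈ [1+α, 4/3]`, (5) `|V''(r)| ≤ α r⁻⁷` for `r ∈ (4/3, ∞)`.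
Real-valued (soft-core) potentials only; see the module docstring. [cite: Theil2006, §1 Theorem 1.1 (2)–(5)] -/
structure IsAdmissible (α : ℝ) (V : ℝ → ℝ) : Prop extends IsNormalized V where
  /-- `V ∈ C²(1-α, ∞)` -/
  contDiffOn : ContDiffOn ℝ 2 V (Ioi (1 - α))
  /-- (2) strong repulsion at short distances -/
  core : ∀ r ∈ Icc (0 : ℝ) (1 - α), 1 / α ≤ V r
  /-- (3) uniform convexity near the equilibrium distance `1` -/
  convex : ∀ r ∈ Ioo (1 - α) (1 + α), 1 ≤ deriv^[2] V r
  /-- (4) the well is not much deeper than at `1` on `[1+α, 4/3]` -/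
  well : ∀ r ∈ Icc (1 + α) (4 / 3 : ℝ), -α ≤ V r
  /-- (5) decay of the second derivative, `|V''(r)| ≤ α r⁻⁷` beyond `4/3` -/
  decay : ∀ r : ℝ, 4 / 3 < r → |deriv^[2] V r| ≤ α * r⁻¹ ^ 7

/-- Coincident particles cost at least `1/α` under (2). [cite: Theil2006, §1 Theorem 1.1 (2)] -/
theorem IsAdmissible.one_div_le_apply_zero {α : ℝ} {V : ℝ → ℝ} (hV : IsAdmissible α V)
    (hα : α ≤ 1) : 1 / α ≤ V 0 :=
  hV.core 0 ⟨le_rfl, by linarith⟩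

/-! ## Finite configurations: the minimum energy -/

/-- The minimum (infimum) `N`-particle energy `min_{y : X_N → ℝ²} E(y)`,
`E(y) = ∑_{{x,x'} ⊂ X_N} V(|y(x) - y(x')|)` (`= interactionEnergy V y`), over ALL configurations
`y : Fin N → ℝ²` (Theil 2006, abstract and Theorem 1.1). A conditionally complete infimum: the
true infimum when `V` is bounded below (`minEnergy_le`), junk `0` otherwise.
[cite: Theil2006, §1 Theorem 1.1] -/
def minEnergy (V : ℝ → ℝ) (N : ℕ) : ℝ :=
  ⨅ y : Fin N → Plane, interactionEnergy V y

/-- For a potential bounded below, `min E ≤ E(y)` for every configuration `y`. [folklore] -/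
theorem minEnergy_le {V : ℝ → ℝ} {c : ℝ} (hc : ∀ r, c ≤ V r) {N : ℕ} (y : Fin N → Plane) :
    minEnergy V N ≤ interactionEnergy V y :=
  ciInf_le ⟨∑ i : Fin N, ((Finset.Ioi i).card : ℝ) * c, by
    rintro _ ⟨y', rfl⟩; exact le_interactionEnergy_of_le V hc y'⟩ y

/-- `y : X_N → ℝ²` is a ground state of `E` (a global minimizer over all configurations).
[cite: Theil2006, §1 Notation] -/
def IsMinimizer (V : ℝ → ℝ) {N : ℕ} (y : Fin N → Plane) : Prop :=
  ∀ y' : Fin N → Plane, interactionEnergy V y ≤ interactionEnergy V y'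

/-! ## Short-range bonds, neighbourhoods and defects (§2.1) -/

section ShortRange

variable (α : ℝ) {N : ℕ} (y : Fin N → Plane)

/-- The short-range bonds `𝒮(y) = {{x,x'} : ||y(x) - y(x')| - 1| ≤ α}` of a configuration,
listed as ordered pairs `x < x'`. [cite: Theil2006, §2.1] -/
def shortRangePairs : Finset (Fin N × Fin N) :=
  Finset.univ.filter fun p => p.1 < p.2 ∧ |dist (y p.1) (y p.2) - 1| ≤ α

/-- The discrete neighbourhood `𝒩(x) = {x' : {x,x'} ∈ 𝒮(y)} ∪ {x}` of a particle.
[cite: Theil2006, §2.1] -/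
def nbhd (x : Fin N) : Finset (Fin N) :=
  insert x (Finset.univ.filter fun x' => |dist (y x) (y x') - 1| ≤ α)

/-- The defects `∂X(y) = {x ∈ X_N : #𝒩(x) ≠ 7}`: particles whose neighbourhood is not a perfect
hexagon (six neighbours plus the particle itself). [cite: Theil2006, §2.1] -/
def defects : Finset (Fin N) :=
  Finset.univ.filter fun x => (nbhd α y x).card ≠ 7

end ShortRange

/-! ## Infinite configurations indexed by `A₂`: periodic and Dirichlet boundary conditions -/

/-- **`L A₂`-periodic configurations** `Y_L^per = {y : A₂ → ℝ² | y(x) - y(x') = x - x' if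
x - x' ∈ L A₂}`, in labels: `y(k + L g) = y(k) + L·(g₁ b₁ + g₂ b₂)`. [cite: Theil2006, §1 Theorem 1.2] -/
def IsPeriodic (L : ℕ) (y : ℤ × ℤ → Plane) : Prop :=
  ∀ k g : ℤ × ℤ, y (k + (L : ℤ) • g) = y k + triPoint ((L : ℤ) • g)

/-- The representative `(m, n)`, `0 ≤ m, n < L`, of a class of `A₂ / L A₂` (the points of
`A₂ ∩ L U` for the half-open unit cell `U` spanned by `b₁, b₂`). [cite: Theil2006, §1 Theorem 1.2] -/
def cellPoint {L : ℕ} (k : Fin L × Fin L) : ℤ × ℤ :=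
  (((k.1 : ℕ) : ℤ), ((k.2 : ℕ) : ℤ))

/-- The **periodic energy** `E_L^per(y) = ∑_{x ∈ A₂ ∩ LU} ∑_{x' ∈ A₂∖{x}} V(|y(x) - y(x')|)`
(Theil 2006, Theorem 1.2): every particle of one period cell interacts with all other particles.
The inner sum is a `tsum` (see the module docstring). [cite: Theil2006, §1 Theorem 1.2] -/
def periodicEnergy (V : ℝ → ℝ) (L : ℕ) (y : ℤ × ℤ → Plane) : ℝ :=
  ∑ k : Fin L × Fin L,
    ∑' k' : {k' : ℤ × ℤ // k' ≠ cellPoint k}, V (dist (y (cellPoint k)) (y k'.1))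

/-- **Dirichlet (clamped) configurations** `Y_𝒜^Dir = {y : A₂ → ℝ² | y(x) = x for all
x ∈ A₂ ∖ 𝒜}` for a finite `𝒜 ⊂ A₂`. [cite: Theil2006, §1 Corollary 1.3] -/
def IsClampedOutside (A : Finset (ℤ × ℤ)) (y : ℤ × ℤ → Plane) : Prop :=
  ∀ k ∉ A, y k = triPoint k

/-- The **Dirichlet energy** `E_𝒜(y) = ∑ V(|y(x) - y(x')|)` over the pairs `{x,x'} ⊂ A₂` meeting
`𝒜` (Theil 2006, Corollary 1.3): pairs inside `𝒜` (each once) plus pairs with exactly one point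
in `𝒜`; the latter inner sum over `A₂ ∖ 𝒜` is a `tsum`. [cite: Theil2006, §1 Corollary 1.3] -/
def dirichletEnergy (V : ℝ → ℝ) (A : Finset (ℤ × ℤ)) (y : ℤ × ℤ → Plane) : ℝ :=
  (∑ k ∈ A, ∑ k' ∈ A.erase k, V (dist (y k) (y k'))) / 2 +
    ∑ k ∈ A, ∑' k' : {k' : ℤ × ℤ // k' ∉ A}, V (dist (y k) (y k'.1))

/-- The undeformed lattice `y(x) = x` is `L A₂`-periodic for every `L`. [folklore] -/
theorem isPeriodic_triPoint (L : ℕ) : IsPeriodic L triPoint := fun k g => by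
  simp only [map_add]

/-- The undeformed lattice `y(x) = x` satisfies every Dirichlet constraint. [folklore] -/
theorem isClampedOutside_triPoint (A : Finset (ℤ × ℤ)) : IsClampedOutside A triPoint :=
  fun _ _ => rfl

/-- An `L A₂`-periodic configuration is determined up to lattice translations by one period:
`y(k + L g) - y(k) ∈ A₂`. [folklore] -/
theorem IsPeriodic.sub_mem {L : ℕ} {y : ℤ × ℤ → Plane} (hy : IsPeriodic L y) (k g : ℤ × ℤ) :
    y (k + (L : ℤ) • g) - y k ∈ triangularLattice :=
  ⟨(L : ℤ) • g, by rw [hy k g]; abel⟩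

end Theil2006

open Theil2006

/-! ## The named facts -/

/-- NAMED FACT — **Theil 2006, Theorem 1.1 (Ground state energy).** "There exists a constant
`α₀ ∈ (0, 1/3)` such that for each `α ∈ (0, α₀)` and every normalized potential `V` which has the
properties `V ∈ C²(1-α, ∞)` and (2) `V(r) ≥ 1/α` for `r ∈ [0, 1-α]`, (3) `V''(r) ≥ 1` for
`r ∈ (1-α, 1+α)`, (4) `V(r) ≥ -α` for `r ∈ [1+α, 4/3]`, (5) `|V''(r)| ≤ α r⁻⁷` for
`r ∈ (4/3, ∞)`, the identity `lim_{N→∞} min_{y : X_N → ℝ²} (1/N) ∑_{{x,x'} ⊂ X_N} V(|y(x) - y(x')|)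
= -3` holds." (`-3 = 6 · V_*(1) / 2`: three bonds per particle in `A₂`, each of renormalized
energy `-1`.) Vendored for real-valued (soft-core) `V`. Users take
`(h : Theil2006_groundStateEnergy)`. [cite: Theil2006, §1 Theorem 1.1] -/
def Theil2006_groundStateEnergy : Prop :=
  ∃ α₀ : ℝ, 0 < α₀ ∧ α₀ < 1 / 3 ∧ ∀ α : ℝ, 0 < α → α < α₀ → ∀ V : ℝ → ℝ, IsAdmissible α V →
    Tendsto (fun N : ℕ => minEnergy V N / N) atTop (𝓝 (-3))

/-- NAMED FACT — **Theil 2006, Lemma 2.2 (Minimum distance).** "There exists a number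
`α₀ ∈ (0, 1/3)` such that for each `α ∈ (0, α₀)` and each `V` satisfying (1)–(5) all ground states
`y_N : X_N → ℝ²` of `E(·)` satisfy the estimate (13) `min_{x ≠ x'} |y(x) - y(x')| > 1 - α`."
Users take `(h : Theil2006_minimumDistance)`. [cite: Theil2006, §2.2 Lemma 2.2 (13)] -/
def Theil2006_minimumDistance : Prop :=
  ∃ α₀ : ℝ, 0 < α₀ ∧ α₀ < 1 / 3 ∧ ∀ α : ℝ, 0 < α → α < α₀ → ∀ V : ℝ → ℝ, IsAdmissible α V →
    ∀ (N : ℕ) (y : Fin N → Plane), IsMinimizer V y → ∀ i j : Fin N, i ≠ j → 1 - α < dist (y i) (y j)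

/-- NAMED FACT — **Theil 2006, Proposition 2.3 with (7) and (18) (combinatorial bound on
short-range bonds).** "There exists `α₀ > 0` such that for all `α ∈ (0, α₀)` and all configurations
`y : X → ℝ²` which satisfy (13) [`min_{x ≠ x'} |y(x) - y(x')| > 1 - α`] estimate (7)
`#𝒮(y) ≤ 3N - ½ #∂X(y)` holds. Furthermore, (18) `#𝒩(x) ≤ 7` for all `x ∈ X`." (The set of
short-range bonds grows like `N`, not `N²`; a `(1-α)`-separated planar point set has at most six
neighbours at distance `≤ 1+α`.) Users take `(h : Theil2006_shortRangeBonds)`.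
[cite: Theil2006, §2.2 Proposition 2.3 (7) (18)] -/
def Theil2006_shortRangeBonds : Prop :=
  ∃ α₀ : ℝ, 0 < α₀ ∧ ∀ α : ℝ, 0 < α → α < α₀ → ∀ (N : ℕ) (y : Fin N → Plane),
    (∀ i j : Fin N, i ≠ j → 1 - α < dist (y i) (y j)) →
      ((shortRangePairs α y).card : ℝ) ≤ 3 * N - ((defects α y).card : ℝ) / 2 ∧
        ∀ x : Fin N, (nbhd α y x).card ≤ 7

/-- NAMED FACT — **Theil 2006, Theorem 1.2 (Ground states with periodic boundary conditions).**
"There exists a constant `α₀ ∈ (0, 1/3)` such that for every pair of numbers `α ∈ (0, α₀)`,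
`L ∈ ℕ`, every potential `V` which satisfies the assumptions of Theorem 1.1 and every ground state
`y_min : A₂ → ℝ²` of `E_L^per(y) = ∑_{x ∈ A₂ ∩ LU} ∑_{x' ∈ A₂∖{x}} V(|y(x) - y(x')|)` subject to
`y ∈ Y_L^per = {y : A₂ → ℝ² | y(x) - y(x') = x - x' if x - x' ∈ L A₂}`, there exists a translation
vector `τ ∈ ℝ²` such that `{y_min(x) + τ | x ∈ A₂} = A₂`." Stated for `L ≥ 1` and real-valued `V`.
**WARNING — MISSTATED AS PRINTED; do not feed to routes.** The transcription above is verbatim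
(checked against the accepted preprint of 26 Aug 2005, pp. 2–3), but the printed conclusion
"translation vector" is false for every `L` with a prime factor `≡ 1 (mod 3)`: the paper's own
proof (§3, p. 14) reaches "`RΩ + τ = A₂` for a rotation `R ∈ SO(2)` and a translation `τ ∈ ℝ²`" and
then wrongly discards `R` "by the periodicity of `y_min`" — coincidence rotations of `A₂` (`Σ7` at
`L = 7`) are periodic too. See `Theil2006Periodic.lean`: the degeneracy
(`Theil2006_periodicGroundStates.no_groundState_seven`) and the corrected named fact
`Theil2006_periodicGroundStates_upToRotation` (conclusion up to a rigid motion, = what the proof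
establishes), with `Theil2006_periodicGroundStates.upToRotation : this → corrected`.
Users take `(h : Theil2006_periodicGroundStates)`. [cite: Theil2006, §1 Theorem 1.2] -/
def Theil2006_periodicGroundStates : Prop :=
  ∃ α₀ : ℝ, 0 < α₀ ∧ α₀ < 1 / 3 ∧ ∀ α : ℝ, 0 < α → α < α₀ → ∀ L : ℕ, 0 < L →
    ∀ V : ℝ → ℝ, IsAdmissible α V → ∀ y : ℤ × ℤ → Plane, IsPeriodic L y →
      (∀ y' : ℤ × ℤ → Plane, IsPeriodic L y' → periodicEnergy V L y ≤ periodicEnergy V L y') →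
        ∃ τ : Plane, Set.range (fun k => y k + τ) = triangularLattice

/-- NAMED FACT — **Theil 2006, Corollary 1.3 (Stability against compactly supported
perturbations).** "Let the assumptions of Theorem 1.2 be satisfied and assume that `𝒜 ⊂ A₂` is an
arbitrary but finite set. If the configuration `y_min : A₂ → ℝ²` is a ground state of
`E_𝒜(y) = ∑_{{x,x'} ⊂ A₂, {x,x'} ∩ 𝒜 ≠ ∅} V(|y(x) - y(x')|)` subject to the constraint
`y ∈ Y_𝒜^Dir = {y : A₂ → ℝ² | y(x) = x for all x ∈ A₂ ∖ 𝒜}`, then `{y_min(x) | x ∈ A₂} = A₂`."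
Users take `(h : Theil2006_dirichletGroundStates)`. [cite: Theil2006, §1 Corollary 1.3] -/
def Theil2006_dirichletGroundStates : Prop :=
  ∃ α₀ : ℝ, 0 < α₀ ∧ α₀ < 1 / 3 ∧ ∀ α : ℝ, 0 < α → α < α₀ → ∀ V : ℝ → ℝ, IsAdmissible α V →
    ∀ (A : Finset (ℤ × ℤ)) (y : ℤ × ℤ → Plane), IsClampedOutside A y →
      (∀ y' : ℤ × ℤ → Plane, IsClampedOutside A y' → dirichletEnergy V A y ≤ dirichletEnergy V A y') →
        Set.range y = triangularLattice

/-! ## API -/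

/-- Under Theorem 1.1, for admissible `V` and every `ε > 0`, eventually every `N`-particle
configuration has energy `≥ (-3 - ε) N` provided `V` is bounded below (so that the infimum is
genuine): the "much harder direction" (6) in per-configuration form. [cite: Theil2006, §2.1 (6)] -/
theorem Theil2006_groundStateEnergy.eventually_le (h : Theil2006_groundStateEnergy) :
    ∃ α₀ : ℝ, 0 < α₀ ∧ ∀ α : ℝ, 0 < α → α < α₀ → ∀ V : ℝ → ℝ, IsAdmissible α V →
      ∀ c : ℝ, (∀ r, c ≤ V r) → ∀ ε : ℝ, 0 < ε →
        ∀ᶠ N : ℕ in atTop, ∀ y : Fin N → Plane, (-3 - ε) * N ≤ interactionEnergy V y := by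
  obtain ⟨α₀, hα₀, -, hmain⟩ := h
  refine ⟨α₀, hα₀, fun α hα hα' V hV c hc ε hε => ?_⟩
  have hlim := hmain α hα hα' V hV
  have hev : ∀ᶠ N : ℕ in atTop, -3 - ε < minEnergy V N / N :=
    hlim.eventually (lt_mem_nhds (by linarith))
  filter_upwards [hev, eventually_gt_atTop 0] with N hN hNpos y
  have hN' : (0 : ℝ) < N := by exact_mod_cast hNpos
  have h1 : (-3 - ε) * N ≤ minEnergy V N := by
    have := (lt_div_iff₀ hN').1 hN
    linarith
  exact h1.trans (minEnergy_le hc y)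

/-- Lemma 2.2 feeds Proposition 2.3: for admissible `V` (with `α` below both thresholds) every
finite ground state has at most `3N - ½ #∂X` short-range bonds and hexagonal-or-smaller
neighbourhoods. [cite: Theil2006, §2.2] -/
theorem Theil2006_shortRangeBonds.of_isMinimizer (h₁ : Theil2006_minimumDistance)
    (h₂ : Theil2006_shortRangeBonds) :
    ∃ α₀ : ℝ, 0 < α₀ ∧ ∀ α : ℝ, 0 < α → α < α₀ → ∀ V : ℝ → ℝ, IsAdmissible α V →
      ∀ (N : ℕ) (y : Fin N → Plane), IsMinimizer V y →
        ((shortRangePairs α y).card : ℝ) ≤ 3 * N - ((defects α y).card : ℝ) / 2 ∧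
          ∀ x : Fin N, (nbhd α y x).card ≤ 7 := by
  obtain ⟨α₁, hα₁, -, h₁⟩ := h₁
  obtain ⟨α₂, hα₂, h₂⟩ := h₂
  refine ⟨min α₁ α₂, lt_min hα₁ hα₂, fun α hα hα' V hV N y hy => ?_⟩
  exact h₂ α hα (hα'.trans_le (min_le_right _ _)) N y
    (h₁ α hα (hα'.trans_le (min_le_left _ _)) V hV N y hy)

/-! ## Theorem 1.1, the upper bound `limsup_N min_y E(y)/N ≤ -3` (PROVED)

The "trivial direction" of Theorem 1.1 (Theil 2006, §2.1): square patches of the triangular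
lattice are trial states of energy `-3N + o(N)`, by normalization (1) alone (`IsNormalized`):
`Theil2006.IsNormalized.eventually_exists_interactionEnergy_le` (configurations) and, for `V`
bounded below on `[0, ∞)` so that `min_y E` is a genuine infimum,
`Theil2006.IsNormalized.eventually_minEnergy_div_le` : `∀ ε > 0, ∀ᶠ N, min_y E / N ≤ -3 + ε`
(and the same for the tree's `groundStateEnergy V 2 N`). The lower bound (6) is the content of
§§2–4 of the paper (Lemma 2.2, Proposition 2.3, the local rigidity estimates of §3 and the
long-range estimates of §4) and is not proved here. -/

/-- `2 E(y) = ∑_x ∑_{x' ≠ x} V(|y(x) - y(x')|)`: the energy counts every unordered pair once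
(a local copy of `two_mul_interactionEnergy` of `LennardJonesClusters`, which is not imported here).
[folklore] -/
private theorem two_mul_interactionEnergy_sum_compl (V : ℝ → ℝ) {d N : ℕ}
    (x : Fin N → EuclideanSpace ℝ (Fin d)) :
    2 * interactionEnergy V x = ∑ i, ∑ j ∈ ({i} : Finset (Fin N))ᶜ, V (dist (x i) (x j)) := by
  have hswap : ∑ i : Fin N, ∑ j ∈ Finset.Ioi i, V (dist (x i) (x j)) =
      ∑ i : Fin N, ∑ j ∈ Finset.Iio i, V (dist (x i) (x j)) := by
    rw [Finset.sum_comm' (t' := Finset.univ) (s' := fun j => Finset.Iio j)]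
    · exact Finset.sum_congr rfl fun j _ => Finset.sum_congr rfl fun i _ => by rw [dist_comm]
    · intro i j
      simp [Finset.mem_Ioi, Finset.mem_Iio]
  unfold interactionEnergy
  simp_rw [← Finset.Ioi_disjUnion_Iio, Finset.sum_disjUnion, Finset.sum_add_distrib, ← hswap,
    two_mul]

/-- A pair potential bounded below by `c` on `[0, ∞)` gives `E(x) ≥ c · N(N-1)/2` (only distances
enter the energy). [folklore] -/
theorem le_interactionEnergy_of_nonneg_le (V : ℝ → ℝ) {c : ℝ} (hc : ∀ r, 0 ≤ r → c ≤ V r)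
    {d N : ℕ} (x : Fin N → EuclideanSpace ℝ (Fin d)) :
    ∑ i : Fin N, ((Finset.Ioi i).card : ℝ) * c ≤ interactionEnergy V x := by
  refine Finset.sum_le_sum fun i _ => ?_
  calc ((Finset.Ioi i).card : ℝ) * c = ∑ _j ∈ Finset.Ioi i, c := by
        rw [Finset.sum_const, nsmul_eq_mul]
    _ ≤ ∑ j ∈ Finset.Ioi i, V (dist (x i) (x j)) :=
        Finset.sum_le_sum fun j _ => hc _ dist_nonneg

namespace Theil2006

/-- Distances in `A₂` are norms of lattice vectors: `|x - x'| = |triPoint (k - k')|`. [folklore] -/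
theorem dist_triPoint (a b : ℤ × ℤ) : dist (triPoint a) (triPoint b) = ‖triPoint (a - b)‖ := by
  rw [dist_eq_norm, map_sub]

/-- The pair potential on the punctured lattice, `ξ ↦ V(|ξ|)` for `ξ ∈ A₂ ∖ {0}` and `0 ↦ 0`
(in labels `k ∈ ℤ²`); its sum over `ℤ²` is the lattice sum (1) at `r = 1`.
[cite: Theil2006, §1 (1)] -/
def latticePotential (V : ℝ → ℝ) (k : ℤ × ℤ) : ℝ :=
  if k = 0 then 0 else V ‖triPoint k‖

/-- The origin carries no self-interaction. [folklore] -/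
@[simp] theorem latticePotential_zero (V : ℝ → ℝ) : latticePotential V 0 = 0 := if_pos rfl

/-- Off the origin the lattice potential is `V(|ξ|)`. [folklore] -/
theorem latticePotential_of_ne (V : ℝ → ℝ) {k : ℤ × ℤ} (hk : k ≠ 0) :
    latticePotential V k = V ‖triPoint k‖ := if_neg hk

/-- `2 E(y) = ∑_x ∑_{x'} V(|ξ_{x'} - ξ_x|)` for a configuration `y(x) = ξ_x` of distinct lattice
points (the diagonal contributes `0`). [folklore] -/
theorem two_mul_interactionEnergy_triPoint (V : ℝ → ℝ) {N : ℕ} {e : Fin N → ℤ × ℤ}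
    (he : Function.Injective e) :
    2 * interactionEnergy V (fun i => triPoint (e i)) =
      ∑ i, ∑ j, latticePotential V (e j - e i) := by
  rw [two_mul_interactionEnergy_sum_compl]
  refine Finset.sum_congr rfl fun i _ => ?_
  rw [← Finset.sum_compl_add_sum {i} fun j => latticePotential V (e j - e i), Finset.sum_singleton,
    sub_self, latticePotential_zero, add_zero]
  refine Finset.sum_congr rfl fun j hj => ?_
  have hij : j ≠ i := by simpa using hj
  rw [latticePotential_of_ne V (sub_ne_zero.2 (he.ne hij)), dist_triPoint, ← neg_sub, map_neg,
    norm_neg]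

/-- Normalization (1) in `ℤ²`-labels: `∑_{k ∈ ℤ²} latticePotential V k = -6` (an absolutely
convergent sum). [cite: Theil2006, §1 (1)] -/
theorem IsNormalized.hasSum_latticePotential {V : ℝ → ℝ} (hV : IsNormalized V) :
    HasSum (latticePotential V) (-6) := by
  have h2 : HasSum (fun k : {k : ℤ × ℤ // k ≠ 0} => V (1 * ‖triPoint k.1‖)) (-6) :=
    (hV.summable 1 one_pos).hasSum_iff.2 hV.latticeSum_one
  simp only [one_mul] at h2
  have key : latticePotential V =
      ({(0 : ℤ × ℤ)}ᶜ : Set (ℤ × ℤ)).indicator fun k => V ‖triPoint k‖ := by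
    funext k
    by_cases hk : k = 0
    · simp [hk]
    · rw [latticePotential_of_ne V hk, Set.indicator_of_mem (by simpa using hk)]
  rw [key]
  exact hasSum_subtype_iff_indicator.1 h2

/-- Tails of an absolutely convergent sum over `ℤ²` are uniformly small off a finite set.
[folklore] -/
theorem exists_finset_tail_lt {g : ℤ × ℤ → ℝ} (hg : Summable g) {ε : ℝ} (hε : 0 < ε) :
    ∃ F : Finset (ℤ × ℤ), (∀ t : Finset (ℤ × ℤ), Disjoint t F → |∑ k ∈ t, g k| < ε) ∧
      |∑' k : {k // k ∉ F}, g k| < ε := by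
  obtain ⟨F₁, h₁⟩ := summable_iff_vanishing_norm.1 hg ε hε
  obtain ⟨F₂, h₂⟩ := eventually_atTop.1
    (Metric.tendsto_nhds.1 (tendsto_tsum_compl_atTop_zero g) ε hε)
  refine ⟨F₁ ∪ F₂, fun t ht => ?_, ?_⟩
  · simpa only [Real.norm_eq_abs] using h₁ t (ht.mono_right Finset.subset_union_left)
  · simpa only [Real.dist_eq, sub_zero] using h₂ (F₁ ∪ F₂) Finset.subset_union_right

/-- **The trial-state estimate.** For a normalized `V` and `ε > 0` there are a finite set
`F ⊂ ℤ²` and `C ≥ 0` such that every configuration of `N` distinct points of `A₂` (labels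
`e : X_N ↪ ℤ²`) has `2 E ≤ (-6 + 2ε) N + C · #{x : e(x) + F ⊄ e(X_N)}`: each particle whose
`F`-neighbourhood is complete contributes at most `-6 + 2ε` (normalization (1) up to the tail of the
lattice sum), every other particle at most `∑_{ξ ≠ 0} |V(|ξ|)|`. [cite: Theil2006, §2.1] -/
theorem IsNormalized.two_mul_interactionEnergy_le {V : ℝ → ℝ} (hV : IsNormalized V) {ε : ℝ}
    (hε : 0 < ε) :
    ∃ (F : Finset (ℤ × ℤ)) (C : ℝ), 0 ≤ C ∧ ∀ (N : ℕ) (e : Fin N → ℤ × ℤ), Function.Injective e →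
      2 * interactionEnergy V (fun i => triPoint (e i)) ≤ (-6 + 2 * ε) * N +
        C * ((Finset.univ.filter fun i => ∃ k ∈ F, e i + k ∉ Finset.univ.image e).card : ℝ) := by
  set g := latticePotential V with hg_def
  have hg : HasSum g (-6) := hV.hasSum_latticePotential
  have hga : Summable fun k => |g k| := hg.summable.abs
  obtain ⟨F, hF, hF'⟩ := exists_finset_tail_lt hg.summable hε
  set M := ∑' k, |g k| with hM_def
  have hM : 0 ≤ M := tsum_nonneg fun k => abs_nonneg _
  have hsplit : ∑ k ∈ F, g k + ∑' k : {k // k ∉ F}, g k = -6 := by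
    rw [← hg.tsum_eq]; exact hg.summable.sum_add_tsum_compl
  refine ⟨F, M + 6, by positivity, fun N e he => ?_⟩
  rw [two_mul_interactionEnergy_triPoint V he]
  -- the per-site sums
  set P : Fin N → ℝ := fun i => ∑ j, g (e j - e i) with hP_def
  set B : Fin N → Prop := fun i => ∃ k ∈ F, e i + k ∉ Finset.univ.image e with hB_def
  have hPT : ∀ i, P i = ∑ k ∈ Finset.univ.image (fun j => e j - e i), g k := by
    intro i
    rw [Finset.sum_image]
    exact (fun a _ b _ h => he (sub_left_injective h))
  -- every site: `P i ≤ M`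
  have hPM : ∀ i, P i ≤ M := by
    intro i
    rw [hPT]
    refine (Finset.sum_le_sum fun k _ => le_abs_self (g k)).trans ?_
    exact hga.sum_le_tsum _ fun k _ => abs_nonneg _
  -- interior sites: `P i ≤ -6 + 2ε`
  have hPint : ∀ i, ¬ B i → P i ≤ -6 + 2 * ε := by
    intro i hi
    simp only [hB_def, not_exists, not_and, not_not] at hi
    have hFT : F ⊆ Finset.univ.image fun j => e j - e i := by
      intro k hk
      obtain ⟨j, -, hj⟩ := Finset.mem_image.1 (hi k hk)
      exact Finset.mem_image.2 ⟨j, Finset.mem_univ _, by rw [hj, add_sub_cancel_left]⟩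
    rw [hPT, ← Finset.sum_sdiff hFT]
    have h1 := hF ((Finset.univ.image fun j => e j - e i) \ F) Finset.sdiff_disjoint
    have h2 : ∑ k ∈ F, g k ≤ -6 + ε := by
      have := neg_abs_le (∑' k : {k // k ∉ F}, g k)
      linarith
    linarith [le_abs_self (∑ k ∈ (Finset.univ.image fun j => e j - e i) \ F, g k)]
  -- add up
  have hcard := Finset.card_filter_add_card_filter_not (s := Finset.univ) B
  simp only [Finset.card_univ, Fintype.card_fin] at hcard
  set b := (Finset.univ.filter B).card with hb_def
  have hb' : ((Finset.univ.filter fun i => ¬ B i).card : ℝ) = N - b := by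
    have : ((Finset.univ.filter B).card : ℝ) + (Finset.univ.filter fun i => ¬ B i).card = N := by
      exact_mod_cast hcard
    linarith
  have hsumB : ∑ i ∈ Finset.univ.filter B, P i ≤ b * M := by
    have := Finset.sum_le_card_nsmul (Finset.univ.filter B) P M fun i _ => hPM i
    rwa [nsmul_eq_mul] at this
  have hsumI : ∑ i ∈ Finset.univ.filter (fun i => ¬ B i), P i ≤ (N - b) * (-6 + 2 * ε) := by
    have := Finset.sum_le_card_nsmul (Finset.univ.filter fun i => ¬ B i) P (-6 + 2 * ε)
      fun i hi => hPint i (Finset.mem_filter.1 hi).2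
    rwa [nsmul_eq_mul, hb'] at this
  have hb0 : (0 : ℝ) ≤ b := Nat.cast_nonneg _
  calc ∑ i, P i
        = ∑ i ∈ Finset.univ.filter B, P i + ∑ i ∈ Finset.univ.filter (fun i => ¬ B i), P i :=
        (Finset.sum_filter_add_sum_filter_not _ _ _).symm
    _ ≤ b * M + (N - b) * (-6 + 2 * ε) := add_le_add hsumB hsumI
    _ = (-6 + 2 * ε) * N + (M + 6) * b - 2 * (ε * b) := by ring
    _ ≤ (-6 + 2 * ε) * N + (M + 6) * b := by nlinarith

/-! ### The trial configurations: square patches of `A₂` -/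

/-- Enumeration of `ℤ²_{≥ 0}` filling squares (`Nat.unpair`): its first `n²` values are exactly
`[0, n)²`, and its first `N` values lie in `[0, √N]²` (auxiliary, for the trial state).
[folklore] -/
private def sqEnum (N : ℕ) (i : Fin N) : ℤ × ℤ :=
  (((Nat.unpair i).1 : ℤ), ((Nat.unpair i).2 : ℤ))

/-- The square-filling enumeration is injective (`Nat.unpair` is a bijection). [folklore] -/
private theorem sqEnum_injective (N : ℕ) : Function.Injective (sqEnum N) := by
  intro i j h
  simp only [sqEnum, Prod.mk.injEq, Nat.cast_inj] at h
  have hij : Nat.unpair i = Nat.unpair j := Prod.ext h.1 h.2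
  apply Fin.ext
  rw [← Nat.pair_unpair (i : ℕ), hij, Nat.pair_unpair]

/-- The first `N` values of the enumeration lie in `[0, ⌊√N⌋]²`. [folklore] -/
private theorem unpair_le_sqrt {N : ℕ} (i : Fin N) :
    (Nat.unpair i).1 ≤ Nat.sqrt N ∧ (Nat.unpair i).2 ≤ Nat.sqrt N := by
  have h := Nat.max_sq_add_min_le_pair (Nat.unpair i).1 (Nat.unpair i).2
  rw [Nat.pair_unpair] at h
  have hmax : max (Nat.unpair i).1 (Nat.unpair i).2 ≤ Nat.sqrt N := by
    refine Nat.le_sqrt'.2 ?_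
    have hi := i.2
    set m := max (Nat.unpair i).1 (Nat.unpair i).2 ^ 2
    omega
  exact ⟨(le_max_left _ _).trans hmax, (le_max_right _ _).trans hmax⟩

/-- The first `N` values of the enumeration cover `[0, ⌊√N⌋)²`. [folklore] -/
private theorem exists_sqEnum_eq {N a b : ℕ} (ha : a < Nat.sqrt N) (hb : b < Nat.sqrt N) :
    ∃ j : Fin N, sqEnum N j = ((a : ℤ), (b : ℤ)) := by
  have hlt : Nat.pair a b < N :=
    calc Nat.pair a b < (max a b + 1) ^ 2 := Nat.pair_lt_max_add_one_sq a b
      _ ≤ Nat.sqrt N ^ 2 := Nat.pow_le_pow_left (max_lt ha hb) 2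
      _ ≤ N := Nat.sqrt_le' N
  exact ⟨⟨Nat.pair a b, hlt⟩, by simp [sqEnum, Nat.unpair_pair]⟩

/-- Sites at distance `≥ R` from the boundary of the square patch have all their `F`-neighbours in
the patch (`F ⊆ [-R, R]²`). [folklore] -/
private theorem sqEnum_add_mem {N R : ℕ} {F : Finset (ℤ × ℤ)}
    (hF : ∀ k ∈ F, |k.1| ≤ R ∧ |k.2| ≤ R) (i : Fin N) (h₁ : R ≤ (Nat.unpair i).1)
    (h₂ : (Nat.unpair i).1 + R < Nat.sqrt N)
    (h₃ : R ≤ (Nat.unpair i).2) (h₄ : (Nat.unpair i).2 + R < Nat.sqrt N) :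
    ∀ k ∈ F, sqEnum N i + k ∈ Finset.univ.image (sqEnum N) := by
  intro k hk
  obtain ⟨hk1, hk2⟩ := hF k hk
  rw [abs_le] at hk1 hk2
  obtain ⟨a, ha⟩ : ∃ a : ℕ, (a : ℤ) = (Nat.unpair i).1 + k.1 :=
    ⟨((Nat.unpair i).1 + k.1).toNat, Int.toNat_of_nonneg (by omega)⟩
  obtain ⟨b, hb⟩ : ∃ b : ℕ, (b : ℤ) = (Nat.unpair i).2 + k.2 :=
    ⟨((Nat.unpair i).2 + k.2).toNat, Int.toNat_of_nonneg (by omega)⟩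
  obtain ⟨j, hj⟩ := exists_sqEnum_eq (N := N) (a := a) (b := b) (by omega) (by omega)
  refine Finset.mem_image.2 ⟨j, Finset.mem_univ _, ?_⟩
  rw [hj]
  ext <;> simp [sqEnum, ha, hb]

/-- At most `(4R + 2)(√N + 1)` of the first `N` sites are within `R` of the boundary. [folklore] -/
private theorem card_boundary_le (N R : ℕ) :
    (Finset.univ.filter fun i : Fin N => (Nat.unpair i).1 < R ∨ Nat.sqrt N ≤ (Nat.unpair i).1 + R ∨
        (Nat.unpair i).2 < R ∨ Nat.sqrt N ≤ (Nat.unpair i).2 + R).card ≤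
      (4 * R + 2) * (Nat.sqrt N + 1) := by
  set n := Nat.sqrt N with hn
  set T : Finset ℕ := Finset.range R ∪ Finset.Icc (n - R) n with hT_def
  set Bx : Finset (ℕ × ℕ) := T ×ˢ Finset.range (n + 1) ∪ Finset.range (n + 1) ×ˢ T with hBx_def
  have hT : T.card ≤ 2 * R + 1 := by
    calc T.card ≤ (Finset.range R).card + (Finset.Icc (n - R) n).card := Finset.card_union_le _ _
      _ ≤ 2 * R + 1 := by rw [Finset.card_range, Nat.card_Icc]; omega
  have hBx : Bx.card ≤ (4 * R + 2) * (n + 1) := by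
    calc Bx.card ≤ (T ×ˢ Finset.range (n + 1)).card + (Finset.range (n + 1) ×ˢ T).card :=
          Finset.card_union_le _ _
      _ = T.card * (n + 1) + (n + 1) * T.card := by
          rw [Finset.card_product, Finset.card_product, Finset.card_range]
      _ ≤ (4 * R + 2) * (n + 1) := by nlinarith [hT]
  refine le_trans (Finset.card_le_card_of_injOn (fun i : Fin N => Nat.unpair i) ?_ ?_) hBx
  · intro i hi
    rw [Finset.coe_filter] at hi
    simp only [Finset.mem_univ, true_and, Set.mem_setOf_eq] at hi
    obtain ⟨hx, hy⟩ := unpair_le_sqrt (N := N) i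
    rw [← hn] at hx hy
    simp only [hBx_def, hT_def, Finset.coe_union, Set.mem_union, Finset.mem_coe, Finset.mem_product,
      Finset.mem_union, Finset.mem_range, Finset.mem_Icc]
    omega
  · intro i _ j _ h
    simp only at h
    exact Fin.ext (by rw [← Nat.pair_unpair (i : ℕ), h, Nat.pair_unpair])

/-- **Theil 2006, Theorem 1.1 — the upper bound (trial state).** For every normalized pair
potential `V` and every `ε > 0`, for all large `N` there is a configuration of `N` distinct points
of the triangular lattice `A₂` (a square patch) with energy `E(y) ≤ (-3 + ε) N`: three bonds per
particle, each of renormalized energy `V_*(1) = -1`, up to boundary and tail corrections `o(N)`.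
This is the direction `limsup_N min_y E/N ≤ -3` of Theorem 1.1; it uses only normalization (1).
[cite: Theil2006, §1 Theorem 1.1 and §2.1] -/
theorem IsNormalized.eventually_exists_interactionEnergy_le {V : ℝ → ℝ} (hV : IsNormalized V)
    {ε : ℝ} (hε : 0 < ε) :
    ∀ᶠ N : ℕ in atTop, ∃ y : Fin N → Plane, Function.Injective y ∧
      Set.range y ⊆ triangularLattice ∧ interactionEnergy V y ≤ (-3 + ε) * N := by
  obtain ⟨F, C, hC, hmain⟩ := hV.two_mul_interactionEnergy_le (half_pos hε)
  -- a box containing `F`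
  obtain ⟨R, hR⟩ : ∃ R : ℕ, ∀ k ∈ F, |k.1| ≤ R ∧ |k.2| ≤ R := by
    refine ⟨F.sup fun k => max k.1.natAbs k.2.natAbs, fun k hk => ?_⟩
    have h := Finset.le_sup (f := fun k : ℤ × ℤ => max k.1.natAbs k.2.natAbs) hk
    simp only [max_le_iff] at h
    constructor
    · rw [← Int.natCast_natAbs]; exact_mod_cast h.1
    · rw [← Int.natCast_natAbs]; exact_mod_cast h.2
  set K : ℝ := C * (4 * R + 2) with hK_def
  have hK : 0 ≤ K := by positivity
  -- threshold: `n = ⌊√N⌋ ≥ n₀` with `n₀ ≥ 1` and `4 K ≤ ε n₀`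
  obtain ⟨n₀, hn₀, hn₀'⟩ : ∃ n₀ : ℕ, 1 ≤ n₀ ∧ 4 * K / ε ≤ n₀ :=
    ⟨⌈4 * K / ε⌉₊ + 1, by omega, (Nat.le_ceil _).trans (by exact_mod_cast Nat.le_succ _)⟩
  filter_upwards [eventually_ge_atTop (n₀ ^ 2)] with N hN
  refine ⟨fun i => triPoint (sqEnum N i), triPoint_injective.comp (sqEnum_injective N), ?_, ?_⟩
  · rintro _ ⟨i, rfl⟩; exact ⟨_, rfl⟩
  have h2E := hmain N (sqEnum N) (sqEnum_injective N)
  -- the boundary sites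
  have hbdry : ((Finset.univ.filter fun i =>
      ∃ k ∈ F, sqEnum N i + k ∉ Finset.univ.image (sqEnum N)).card : ℝ) ≤
        (4 * R + 2) * (Nat.sqrt N + 1) := by
    have hsub : (Finset.univ.filter fun i =>
        ∃ k ∈ F, sqEnum N i + k ∉ Finset.univ.image (sqEnum N)) ⊆
        Finset.univ.filter fun i : Fin N => (Nat.unpair i).1 < R ∨
          Nat.sqrt N ≤ (Nat.unpair i).1 + R ∨ (Nat.unpair i).2 < R ∨
            Nat.sqrt N ≤ (Nat.unpair i).2 + R := by
      intro i hi
      simp only [Finset.mem_filter, Finset.mem_univ, true_and] at hi ⊢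
      by_contra hcon
      simp only [not_or, not_lt, not_le] at hcon
      obtain ⟨k, hk, hk'⟩ := hi
      exact hk' (sqEnum_add_mem hR i hcon.1 hcon.2.1 hcon.2.2.1 hcon.2.2.2 k hk)
    have := (Finset.card_le_card hsub).trans (card_boundary_le N R)
    exact_mod_cast this
  -- arithmetic
  set n := Nat.sqrt N with hn_def
  have hn₀n : n₀ ≤ n := Nat.le_sqrt'.2 hN
  have hn1 : (1 : ℝ) ≤ n := by exact_mod_cast hn₀.trans hn₀n
  have hKn : 4 * K ≤ ε * n := by
    have : (n₀ : ℝ) ≤ n := by exact_mod_cast hn₀n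
    rw [div_le_iff₀ hε] at hn₀'
    nlinarith
  have hnN : (n : ℝ) ^ 2 ≤ N := by exact_mod_cast Nat.sqrt_le' N
  have h1 : C * ((Finset.univ.filter fun i =>
      ∃ k ∈ F, sqEnum N i + k ∉ Finset.univ.image (sqEnum N)).card : ℝ) ≤ K * (n + 1) := by
    calc _ ≤ C * ((4 * R + 2) * (Nat.sqrt N + 1)) := mul_le_mul_of_nonneg_left hbdry hC
      _ = K * (n + 1) := by rw [hK_def, hn_def]; ring
  have h2 : K * (n + 1) ≤ 2 * K * n := by nlinarith
  have h3 : 2 * K * n ≤ ε / 2 * n * n := by nlinarith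
  have h4 : ε / 2 * n * n ≤ ε / 2 * N := by nlinarith
  have h5 : 2 * interactionEnergy V (fun i => triPoint (sqEnum N i)) ≤ (-6 + 2 * ε) * N := by
    have : (-6 + 2 * (ε / 2)) * (N : ℝ) = (-6 + ε) * N := by ring
    linarith
  linarith

/-! ### Consequences for the minimum energy -/

/-- For a potential bounded below on `[0, ∞)`, `min E ≤ E(y)` for every configuration.
[folklore] -/
theorem minEnergy_le_of_nonneg {V : ℝ → ℝ} {c : ℝ} (hc : ∀ r, 0 ≤ r → c ≤ V r) {N : ℕ}
    (y : Fin N → Plane) : minEnergy V N ≤ interactionEnergy V y :=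
  ciInf_le ⟨∑ i : Fin N, ((Finset.Ioi i).card : ℝ) * c, by
    rintro _ ⟨y', rfl⟩; exact le_interactionEnergy_of_nonneg_le V hc y'⟩ y

/-- **Theorem 1.1, upper bound for the minimum energy:** for a normalized potential bounded below
on `[0, ∞)` (so that `min_y E` is a genuine infimum) and every `ε > 0`, eventually
`min_y E(y) / N ≤ -3 + ε`. [cite: Theil2006, §1 Theorem 1.1 and §2.1] -/
theorem IsNormalized.eventually_minEnergy_div_le {V : ℝ → ℝ} (hV : IsNormalized V) {c : ℝ}
    (hc : ∀ r, 0 ≤ r → c ≤ V r) {ε : ℝ} (hε : 0 < ε) :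
    ∀ᶠ N : ℕ in atTop, minEnergy V N / N ≤ -3 + ε := by
  filter_upwards [hV.eventually_exists_interactionEnergy_le hε, eventually_gt_atTop 0] with N hN hN0
  obtain ⟨y, -, -, hy⟩ := hN
  rw [div_le_iff₀ (by exact_mod_cast hN0)]
  exact (minEnergy_le_of_nonneg hc y).trans hy

/-- The same upper bound for the tree's `groundStateEnergy V 2 N` (infimum over configurations of
distinct points, Blanc–Lewin (2)): the trial state consists of distinct lattice points.
[cite: Theil2006, §1 Theorem 1.1 and §2.1] -/
theorem IsNormalized.eventually_groundStateEnergy_div_le {V : ℝ → ℝ} (hV : IsNormalized V)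
    {c : ℝ} (hc : ∀ r, 0 ≤ r → c ≤ V r) {ε : ℝ} (hε : 0 < ε) :
    ∀ᶠ N : ℕ in atTop, groundStateEnergy V 2 N / N ≤ -3 + ε := by
  filter_upwards [hV.eventually_exists_interactionEnergy_le hε, eventually_gt_atTop 0] with N hN hN0
  obtain ⟨y, hy_inj, -, hy⟩ := hN
  rw [div_le_iff₀ (by exact_mod_cast hN0)]
  refine (groundStateEnergy_le V ⟨∑ i : Fin N, ((Finset.Ioi i).card : ℝ) * c, ?_⟩ hy_inj).trans hy
  rintro _ ⟨y', rfl⟩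
  exact le_interactionEnergy_of_nonneg_le V hc y'.1

end Theil2006

end Literature.MathematicalPhysics.StatisticalMechanics

end
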